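import Summits.BirchSwinnertonDyer.Rank1Residual.ManinAdditive.SigmaEtaKummer
import HarnessLib
import HarnessLib.Audit.Tags

/-!
# SigmaTheta-an-g34 — cell bsd-f2-manin, seat -an g34, MEMO-an §77.12.  NOTHING ASSERTED beyond the `decide`d rungs.

TYPER NOTE (typer g18, T-an-36).  SOURCE = HOME/an/g34/SigmaTheta-an-g34.lean sha16 42a105e00775e301 (68 l.; an: rc 0, nothing admitted — the rungs are
`decide`d), landed VERBATIM except: (i) this note; (ii) the two copied definitions `IsShimuraTwoChar` / `HasEvenCuspOrders` replaced by
`import …ManinAdditive.SigmaEtaKummer` (T-an-35, p707687), as the sketch itself asks; (iii) `@[conjecture]` on E-an-156 `ShimuraTwoCharIffFactorsThrough`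
and E-an-157 `ThetaFamilyIntegral` (an: THEOREM-grade, routine / proved by hand in MEMO-an §77.12 — obligation nodes until a prover discharges them;
the three rungs below are kernel-decided instances); (iv) §3 added from an's UPDATED checked skeleton HOME/an/g34/EtaSquareSigmaSkeleton-an-g34.lean
sha16 dfce770e014ee5e2 (the stub shrunk by the tree's `prod_jacobiSym_conj_zpow_eq`): node **S-an-g34-2 `KroneckerShimuraCharAtFour`** (the new stub
`stub_kroneckerShimuraChar` verbatim as a Prop) and the PROVED bridges `shimuraTwoCharOfJacobiProductAtFour_of_kronecker : S-an-g34-2 → S-an-g34-1`,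
`etaSquareKummerIsSigmaAtFour_of_kronecker : S-an-g34-2 → E-an-155` (so E-an-155 is proved modulo the purely arithmetic node S-an-g34-2:
reciprocity + two parity lemmas + the conductor bound, MEMO-an §77.11–77.12; prover ask T-an-35′).  ROUTE-INDEPENDENT; no Literature fact created.
HONEST FRAMING.  LENS: an.  STATUS: E-an-156/157 theorem-grade candidates (unproved in Lean), S-an-g34-2 node; BC5: ENGINE 2 H1F2-4N-v1.tsv
02afa8ee56df14a3 268/268 levels; falsifier run thetacheck.py 9e7973a4da3392e8 / THETACHECK-4N400-v1.log 505c78925b4edf79: every `4 ∣ N ≤ 400` ×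
every admissible `m`: 108/108 OK, 0 FAIL; numerics `m < 300` for E-an-157.  REFUTER VERDICTS: R-an-63/64 PENDING.  WHY IT MATTERS (an §77.12 (8)):
the blind classes of C2's stub 6♭ ARE theta classes (80a1/80b1 = Θ₅, 48a1 = Θ₃ @24, 32a1/64a1/128b1/128d1 = Θ₂ @32, 208c1 = Θ₁₃, 464e1 = Θ₂₉,
848d1 = Θ₅₃); blind `T` ⟺ the Stevens isogeny `E₀ → E₁` has even degree.  PARTITION currency: 0; beyond-print theorem: NO; bears_on:
stmt-BirchSwinnertonDyer-22967.  BSD is not proved by this; Manin's conjecture is not proved; C2/C3 OPEN.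
[cite: Newman1959, Thm. 1 (η-quotient multipliers; shape)] [cite: LingOesterle1991, Thm. 6 (the Shimura subgroup; shape)]

The THETA FAMILY behind the level law `V_sq = Σ(N)[2]` (E-an-154/155): `Θ_m(τ) := θ(mτ)/θ(τ)`, `θ = Σ qⁿ² = η(2τ)⁵/(η(τ)²η(4τ)²)`,
is the `η`-quotient with exponent vector `thetaVec m = 2[1] − 5[2] + 2[4] − 2[m] + 5[2m] − 2[4m]`; its square-class kernel is `m`, its
multiplier on `Γ₀(4m)` is the Kronecker character `(m/·)` (theta multiplier system, print), and (E-an-157) its cusp orders are integral on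
`Γ₀(4m)` iff `m ≡ 1 (4)`, on `Γ₀(8m)` for every odd `m`, and for `m = 2` on `Γ₀(32)` (not `Γ₀(16)`).  E-an-156: a `±1`-valued Dirichlet
character `χ mod N` kills every cusp stabiliser of `Γ₀(N)` iff it factors through `N₁ = ∏ p^{⌈v_p(N)/2⌉}` (`shimuraRadical N`).
Together with E-an-155 these give E-an-154 constructively (MEMO-an §77.12).  The defs `IsShimuraTwoChar`, `HasEvenCuspOrders` are copied
verbatim from Sketch-an-g34.lean (replace by an import once `…/ManinAdditive/SigmaEtaKummer.lean` lands).
-/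

namespace Summit.BirchSwinnertonDyer.Rank1Residual.ManinAdditive.SigmaEta

open Literature.NumberTheory.ModularForms
open Literature.NumberTheory.EllipticCurves.ModularForms
open scoped NumberTheorySymbols

/-! ## §1 The Shimura radical and the theta family: E-an-156 / E-an-157 (SigmaTheta-an-g34 42a105e00775e301, verbatim) -/

/-- `N₁ = ∏_{p ∣ N} p^{⌈v_p(N)/2⌉}` — the modulus through which exactly the cusp-unramified characters factor. -/
def shimuraRadical (N : ℕ) : ℕ := ∏ p ∈ N.primeFactors, p ^ ((N.factorization p + 1) / 2)

/-- **E-an-156** (THEOREM-grade, routine): for `4 ∣ N`, a quadratic character `χ mod N` is a Shimura 2-character iff it is even and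
factors through `shimuraRadical N`; hence `dim Σ(N)[2] = A + max(B − 1, 0)` (`4 ∥ N`), `A + B` (`8 ∥ N`, `16 ∥ N`), `A + B + 1`
(`32 ∣ N`), `A`/`B` = number of prime divisors `≡ 1`/`≡ 3 (mod 4)` — ENGINE 2: 268/268 levels. -/
@[conjecture]
def ShimuraTwoCharIffFactorsThrough : Prop :=
  ∀ N : ℕ, 4 ∣ N → ∀ χ : DirichletCharacter ℤ N,
    IsShimuraTwoChar N χ ↔ (χ (-1) = 1 ∧ χ.FactorsThrough (shimuraRadical N))

/-- Exponent vector of `Θ_m = θ(mτ)/θ(τ)`, `θ = η(2τ)⁵/(η(τ)²η(4τ)²)` (coincident divisors add). -/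
def thetaVec (m : ℕ) (t : ℕ) : ℤ :=
  (if t = 1 then 2 else 0) + (if t = 2 then -5 else 0) + (if t = 4 then 2 else 0) +
    (if t = m then -2 else 0) + (if t = 2 * m then 5 else 0) + (if t = 4 * m then -2 else 0)

/-- **E-an-157** (THEOREM-grade; proved by hand in MEMO-an §77.12, checked numerically for all odd `m < 300`): Newman's conditions for
`2·thetaVec m` and integral cusp orders of `Θ_m` hold on `Γ₀(8m)` for every odd `m`, and on `Γ₀(4m)` iff `m ≡ 1 (mod 4)`. -/
@[conjecture]
def ThetaFamilyIntegral : Prop :=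
  ∀ m : ℕ, Odd m →
    (NewmanCond (8 * m) (fun t => 2 * thetaVec m t) 0 ∧ HasEvenCuspOrders (8 * m) (fun t => 2 * thetaVec m t)) ∧
    (m % 4 = 1 ↔ HasEvenCuspOrders (4 * m) (fun t => 2 * thetaVec m t))

/-! ## §2 Rungs (kernel-decided instances; verbatim) -/

/-- `Θ₅` on `Γ₀(20)`: integral orders (the blind class `χ₅` of `80a1/80b1` lives here). -/
theorem thetaFive_rung : HasEvenCuspOrders 20 (fun t => 2 * thetaVec 5 t) := by
  unfold HasEvenCuspOrders cuspOrder24 thetaVec; decide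

/-- `Θ₃`: integral on `Γ₀(24)` but NOT on `Γ₀(12)` (`χ₁₂ ∈ Σ(24)[2]`, `Σ(12)[2] = 0`). -/
theorem thetaThree_rung :
    HasEvenCuspOrders 24 (fun t => 2 * thetaVec 3 t) ∧ ¬ HasEvenCuspOrders 12 (fun t => 2 * thetaVec 3 t) := by
  unfold HasEvenCuspOrders cuspOrder24 thetaVec; decide

/-- `Θ₂`: integral on `Γ₀(32)` but NOT on `Γ₀(16)` (`χ₈ ∈ Σ(32)[2]`, `Σ(16)[2] = 0`). -/
theorem thetaTwo_rung :
    HasEvenCuspOrders 32 (fun t => 2 * thetaVec 2 t) ∧ ¬ HasEvenCuspOrders 16 (fun t => 2 * thetaVec 2 t) := by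
  unfold HasEvenCuspOrders cuspOrder24 thetaVec; decide

/-! ## §3 E-an-155 modulo the SMALLER node S-an-g34-2 (an's updated skeleton EtaSquareSigmaSkeleton-an-g34.lean dfce770e014ee5e2) -/

/-- **Node S-an-g34-2 `KroneckerShimuraCharAtFour`** (an's `stub_kroneckerShimuraChar`; purely arithmetic after the tree's
`prod_jacobiSym_conj_zpow_eq`, which turns the Jacobi part `∏_t (c/t | |d|)^{r_t}` of Newman's multiplier into ONE Kronecker symbol
`(s' | |d|)`, `s' = ∏ t^{|r_t|}`; nothing asserted): at `4 ∣ N`, for `2r` with Newman's congruences and even cusp orders, `d ↦ (s' | |d|)` on odd `d`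
coprime to `N` is an even quadratic Dirichlet character mod `N` killing the cusp stabilisers (an: reciprocity + the parity lemmas «`v₂(s')` odd ⟹
`32 ∣ N`», «`#{p ≡ 3 (4) : v_p(s') odd}` odd ⟹ `8 ∣ N`» from integral cusp orders + the conductor bound `v_p(cond χ) ≤ ⌈v_p(N)/2⌉`;
MEMO-an §77.11–77.12; prover ask T-an-35′).  Why it might fail: only through a slip in the parity lemmas (falsifier run 108/108 at `4 ∣ N ≤ 400`). -/
@[conjecture]
def KroneckerShimuraCharAtFour : Prop :=
  ∀ (N : ℕ), 4 ∣ N → ∀ r : ℕ → ℤ, NewmanCond N (fun t => 2 * r t) 0 → HasEvenCuspOrders N (fun t => 2 * r t) →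
    ∃ χ : DirichletCharacter ℤ N, IsShimuraTwoChar N χ ∧
      ∀ d : ℤ, Odd d → IsCoprime d N →
        J(((∏ t ∈ N.divisors, t ^ (r t).natAbs : ℕ) : ℤ) | d.natAbs) = χ (d : ZMod N)

/-- **S-an-g34-2 ⟹ S-an-g34-1** (the Jacobi-product node of `SigmaEtaKummer.lean`): on `Γ₀(N)` with `4 ∣ N ∣ c`, `c > 0`, `gcd(c, d) = 1` the
entry `d` is odd and coprime to `N`, `Σ r_t = 0` by Newman's weight condition, so the tree's `prod_jacobiSym_conj_zpow_eq` rewrites the Jacobi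
product as the Kronecker symbol of the node (an's steps, verbatim). -/
theorem shimuraTwoCharOfJacobiProductAtFour_of_kronecker (hK : KroneckerShimuraCharAtFour) :
    ShimuraTwoCharOfJacobiProductAtFour := by
  intro N hN r hnc hev
  obtain ⟨χ, hχ, hkron⟩ := hK N hN r hnc hev
  refine ⟨χ, hχ, fun c d _ hNc hcd => ?_⟩
  have hsum0 : ∑ t ∈ N.divisors, r t = 0 := by
    have h := hnc.sum_eq
    simp only [mul_zero] at h
    rw [← Finset.mul_sum] at h
    linarith [h]
  have hceven : Even c := by
    obtain ⟨k, hk⟩ := hNc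
    obtain ⟨m, hm⟩ := hN
    exact ⟨k * 2 * m, by rw [hk, hm]; push_cast; ring⟩
  have hd : Odd d := by
    by_contra h
    rw [Int.not_odd_iff_even] at h
    obtain ⟨u, v, huv⟩ := hcd
    have : Even (u * c + v * d) := (hceven.mul_left u).add (h.mul_left v)
    rw [huv] at this
    exact Int.not_even_one this
  have hdN : IsCoprime d (N : ℤ) := by
    obtain ⟨k, hk⟩ := hNc
    have : IsCoprime d c := hcd.symm
    rw [hk] at this
    exact this.of_mul_right_left
  rw [prod_jacobiSym_conj_zpow_eq N r hsum0 hNc hcd hd, hkron d hd hdN]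

/-- **S-an-g34-2 ⟹ E-an-155** (composition with `etaSquareKummerIsSigmaAtFour_of_jacobiProduct` of `SigmaEtaKummer.lean`). -/
theorem etaSquareKummerIsSigmaAtFour_of_kronecker (hK : KroneckerShimuraCharAtFour) : EtaSquareKummerIsSigmaAtFour :=
  etaSquareKummerIsSigmaAtFour_of_jacobiProduct (shimuraTwoCharOfJacobiProductAtFour_of_kronecker hK)

end Summit.BirchSwinnertonDyer.Rank1Residual.ManinAdditive.SigmaEta
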